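import Summits.CriticalPhenomena.SAWScalingLimit.Theorems.SAWRenewalTightnessRoomEntropyDefs
import Mathlib.Analysis.SpecialFunctions.BinaryEntropy
import Mathlib.Analysis.SpecialFunctions.Trigonometric.Deriv
import Mathlib.Analysis.SpecialFunctions.Log.Deriv
import Mathlib.Analysis.Calculus.Deriv.Pow
import HarnessLib

/-!
# `stub_roomProfileODE`: the room profile solves the κ = 8/3 Feynman–Kac ODE

Stub `stub_roomProfileODE` (sanity anchor F3a) of the registered skeleton of the line
`room-entropy-wright-fisher` for the crux `SubseqIdentification` (stmt-CriticalPhenomena-0783,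
route `SAWRenewalTightness`; vocabulary `Theorems/SAWRenewalTightnessRoomEntropyDefs.lean`).

The κ = 8/3 room profile is `Λ(θ) = roomProfile θ = 3·H(sin²(θ/2))`, `H = Real.binEntropy`
(nats).  The κ = 8/3 Feynman–Kac ODE `(κ/2) sin θ Λ'' + (κ − 4) cos θ Λ' = −4 sin θ` reads
`sin θ Λ'' − cos θ Λ' = −3 sin θ` on `(0, π)`; this file certifies it in the kernel.

Computation.  `H'(p) = log(1 − p) − log p` (`Real.hasDerivAt_binEntropy`); with
`p(θ) = sin²(θ/2)`, `p'(θ) = sin(θ/2) cos(θ/2) = (sin θ)/2`, and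
`1 − p = cos²(θ/2) = (1 + cos θ)/2`, `p = (1 − cos θ)/2`, so on `(0, π)`
`Λ'(θ) = (3/2) sin θ (log(1 + cos θ) − log(1 − cos θ))`.  Since `(0, π)` is open,
`deriv roomProfile` agrees with this closed form near every point of `(0, π)`, so the second
derivative is the derivative of the closed form (product rule); and
`d/dθ [log(1 + cos θ) − log(1 − cos θ)] = −sin θ/(1 + cos θ) − sin θ/(1 − cos θ) = −2/sin θ`
(`1 − cos²θ = sin²θ`), whence `Λ''(θ) = (3/2) cos θ (log(1+cos θ) − log(1−cos θ)) − 3` and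
`sin θ Λ'' − cos θ Λ' = −3 sin θ`.

No named fact is used; axioms `propext`, `Classical.choice`, `Quot.sound`.
-/

noncomputable section

open MeasureTheory Filter Topology Set
open scoped NNReal ENNReal Classical BigOperators

namespace Summit.CriticalPhenomena.SAWScalingLimit.Theorems.SubseqIdentification.RoomEntropy

/-- `d/dθ sin²(θ/2) = (sin θ)/2`. -/
private theorem hasDerivAt_sin_half_sq (θ : ℝ) :
    HasDerivAt (fun x => Real.sin (x / 2) ^ 2) (Real.sin θ / 2) θ := by
  have h1 : HasDerivAt (fun x : ℝ => x / 2) (1 / 2) θ := (hasDerivAt_id θ).div_const 2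
  have h2 : HasDerivAt (fun x : ℝ => Real.sin (x / 2)) (Real.cos (θ / 2) * (1 / 2)) θ := h1.sin
  have h3 := h2.fun_pow 2
  refine h3.congr_deriv ?_
  have hs : Real.sin θ = 2 * Real.sin (θ / 2) * Real.cos (θ / 2) := by
    rw [← Real.sin_two_mul]; congr 1; ring
  rw [hs]
  simp only [Nat.cast_ofNat, Nat.add_one_sub_one, pow_one]
  ring

/-- On `(0, π)`: `0 < 1 + cos θ` and `0 < 1 - cos θ`. -/
private theorem one_add_cos_pos_one_sub_cos_pos {θ : ℝ} (hθ : θ ∈ Ioo (0 : ℝ) Real.pi) :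
    0 < 1 + Real.cos θ ∧ 0 < 1 - Real.cos θ := by
  obtain ⟨h0, hπ⟩ := hθ
  have hs2 : 0 < Real.sin (θ / 2) := Real.sin_pos_of_pos_of_lt_pi (by linarith) (by linarith)
  have hc2 : 0 < Real.cos (θ / 2) := Real.cos_pos_of_mem_Ioo ⟨by linarith, by linarith⟩
  have hcs := Real.cos_sq (θ / 2)
  have hss := Real.sin_sq_eq_half_sub (θ / 2)
  rw [show 2 * (θ / 2) = θ by ring] at hcs hss
  constructor
  · nlinarith [pow_pos hc2 2]
  · nlinarith [pow_pos hs2 2]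

/-- The room profile is differentiable on `(0, π)` with derivative
`Λ'(θ) = (3/2) sin θ (log(1 + cos θ) − log(1 − cos θ))` (half-angle-free form of
`3 H'(sin²(θ/2)) · (sin θ)/2`). -/
private theorem hasDerivAt_roomProfile {θ : ℝ} (hθ : θ ∈ Ioo (0 : ℝ) Real.pi) :
    HasDerivAt roomProfile
      (3 / 2 * Real.sin θ * (Real.log (1 + Real.cos θ) - Real.log (1 - Real.cos θ))) θ := by
  obtain ⟨hpos1, hpos2⟩ := one_add_cos_pos_one_sub_cos_pos hθ
  obtain ⟨h0, hπ⟩ := hθ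
  have hs2 : 0 < Real.sin (θ / 2) := Real.sin_pos_of_pos_of_lt_pi (by linarith) (by linarith)
  have hc2 : 0 < Real.cos (θ / 2) := Real.cos_pos_of_mem_Ioo ⟨by linarith, by linarith⟩
  have hcs := Real.cos_sq (θ / 2)
  have hss := Real.sin_sq_eq_half_sub (θ / 2)
  rw [show 2 * (θ / 2) = θ by ring] at hcs hss
  have hp0 : Real.sin (θ / 2) ^ 2 ≠ 0 := by positivity
  have hp1 : Real.sin (θ / 2) ^ 2 ≠ 1 := by
    intro h
    have hc0 : Real.cos (θ / 2) ^ 2 = 0 := by nlinarith [Real.sin_sq_add_cos_sq (θ / 2)]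
    exact (pow_pos hc2 2).ne' hc0
  have hH := Real.hasDerivAt_binEntropy hp0 hp1
  have hcomp : HasDerivAt (fun x => Real.binEntropy (Real.sin (x / 2) ^ 2))
      ((Real.log (1 - Real.sin (θ / 2) ^ 2) - Real.log (Real.sin (θ / 2) ^ 2)) *
        (Real.sin θ / 2)) θ := by
    have hc := hH.comp θ (hasDerivAt_sin_half_sq θ)
    exact hc
  have h3 := hcomp.const_mul 3
  have hfun : roomProfile = fun x => 3 * Real.binEntropy (Real.sin (x / 2) ^ 2) := by
    funext x; rfl
  rw [hfun]
  refine h3.congr_deriv ?_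
  have hcos : 1 - Real.sin (θ / 2) ^ 2 = (1 + Real.cos θ) / 2 := by linarith
  have hsin : Real.sin (θ / 2) ^ 2 = (1 - Real.cos θ) / 2 := by linarith
  rw [hcos, hsin, Real.log_div hpos1.ne' two_ne_zero, Real.log_div hpos2.ne' two_ne_zero]
  ring

/-- Near every point of the open interval `(0, π)`, `deriv roomProfile` is the closed form
`x ↦ (3/2) sin x (log(1 + cos x) − log(1 − cos x))`. -/
private theorem deriv_roomProfile_eventuallyEq {θ : ℝ} (hθ : θ ∈ Ioo (0 : ℝ) Real.pi) :
    deriv roomProfile =ᶠ[𝓝 θ]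
      fun x => 3 / 2 * Real.sin x * (Real.log (1 + Real.cos x) - Real.log (1 - Real.cos x)) := by
  filter_upwards [isOpen_Ioo.mem_nhds hθ] with x hx
  exact (hasDerivAt_roomProfile hx).deriv

/-- The closed form of `Λ'` is differentiable on `(0, π)`; its derivative by the product rule is
`(3/2) cos θ (log(1+cos θ) − log(1−cos θ)) + (3/2) sin θ (−sin θ/(1+cos θ) − sin θ/(1−cos θ))`. -/
private theorem hasDerivAt_deriv_roomProfile_closedForm {θ : ℝ} (hθ : θ ∈ Ioo (0 : ℝ) Real.pi) :
    HasDerivAt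
      (fun x => 3 / 2 * Real.sin x * (Real.log (1 + Real.cos x) - Real.log (1 - Real.cos x)))
      (3 / 2 * Real.cos θ * (Real.log (1 + Real.cos θ) - Real.log (1 - Real.cos θ)) +
        3 / 2 * Real.sin θ *
          (-Real.sin θ / (1 + Real.cos θ) - Real.sin θ / (1 - Real.cos θ))) θ := by
  obtain ⟨hpos1, hpos2⟩ := one_add_cos_pos_one_sub_cos_pos hθ
  have hA : HasDerivAt (fun x => 1 + Real.cos x) (-Real.sin θ) θ :=
    (Real.hasDerivAt_cos θ).const_add 1
  have hB : HasDerivAt (fun x => 1 - Real.cos x) (Real.sin θ) θ := by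
    simpa using (Real.hasDerivAt_cos θ).const_sub 1
  have hLA : HasDerivAt (fun x => Real.log (1 + Real.cos x))
      (-Real.sin θ / (1 + Real.cos θ)) θ := hA.log hpos1.ne'
  have hLB : HasDerivAt (fun x => Real.log (1 - Real.cos x))
      (Real.sin θ / (1 - Real.cos θ)) θ := hB.log hpos2.ne'
  have hL := hLA.fun_sub hLB
  have hS : HasDerivAt (fun x => 3 / 2 * Real.sin x) (3 / 2 * Real.cos θ) θ :=
    (Real.hasDerivAt_sin θ).const_mul (3 / 2)
  exact hS.fun_mul hL

/-- **The room profile solves the κ = 8/3 Feynman–Kac ODE** (registered stub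
`stub_roomProfileODE`, sanity anchor F3a of the line `room-entropy-wright-fisher`, crux
`SubseqIdentification`, stmt-CriticalPhenomena-0783): on `(0, π)`,
`sin θ · Λ''(θ) − cos θ · Λ'(θ) = −3 sin θ` for `Λ = roomProfile = 3·H(sin²(·/2))`,
i.e. `(κ/2) sin θ Λ'' + (κ − 4) cos θ Λ' = −4 sin θ` at `κ = 8/3`.  Proof: chain rule through
`Real.hasDerivAt_binEntropy` gives the closed form `Λ'(θ) = (3/2) sin θ (log(1 + cos θ) −
log(1 − cos θ))` on the open interval, hence `Λ''` is the derivative of that closed form there,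
and the identity is the algebra `−sin θ/(1+cos θ) − sin θ/(1−cos θ) = −2/sin θ`. -/
theorem stub_roomProfileODE :
    ∀ θ ∈ Ioo (0 : ℝ) Real.pi,
      Real.sin θ * deriv (deriv roomProfile) θ - Real.cos θ * deriv roomProfile θ
        = -3 * Real.sin θ := by
  intro θ hθ
  have h1 : deriv roomProfile θ
      = 3 / 2 * Real.sin θ * (Real.log (1 + Real.cos θ) - Real.log (1 - Real.cos θ)) :=
    (hasDerivAt_roomProfile hθ).deriv
  have h2 : deriv (deriv roomProfile) θ
      = 3 / 2 * Real.cos θ * (Real.log (1 + Real.cos θ) - Real.log (1 - Real.cos θ)) +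
        3 / 2 * Real.sin θ *
          (-Real.sin θ / (1 + Real.cos θ) - Real.sin θ / (1 - Real.cos θ)) := by
    rw [(deriv_roomProfile_eventuallyEq hθ).deriv_eq]
    exact (hasDerivAt_deriv_roomProfile_closedForm hθ).deriv
  obtain ⟨hpos1, hpos2⟩ := one_add_cos_pos_one_sub_cos_pos hθ
  obtain ⟨h0, hπ⟩ := hθ
  have hsin : 0 < Real.sin θ := Real.sin_pos_of_pos_of_lt_pi h0 hπ
  have hprod : (1 + Real.cos θ) * (1 - Real.cos θ) = Real.sin θ ^ 2 := by
    rw [Real.sin_sq]; ring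
  have key : -Real.sin θ / (1 + Real.cos θ) - Real.sin θ / (1 - Real.cos θ)
      = -2 / Real.sin θ := by
    rw [div_sub_div _ _ hpos1.ne' hpos2.ne', hprod, div_eq_div_iff (pow_ne_zero 2 hsin.ne')
      hsin.ne']
    ring
  have hcancel : Real.sin θ * (-2 / Real.sin θ) = -2 := by
    field_simp
  rw [h1, h2, key]
  calc Real.sin θ * (3 / 2 * Real.cos θ * (Real.log (1 + Real.cos θ) - Real.log (1 - Real.cos θ))
          + 3 / 2 * Real.sin θ * (-2 / Real.sin θ))
        - Real.cos θ * (3 / 2 * Real.sin θ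
          * (Real.log (1 + Real.cos θ) - Real.log (1 - Real.cos θ)))
        = 3 / 2 * Real.sin θ * (Real.sin θ * (-2 / Real.sin θ)) := by ring
    _ = -3 * Real.sin θ := by rw [hcancel]; ring

end Summit.CriticalPhenomena.SAWScalingLimit.Theorems.SubseqIdentification.RoomEntropy

end
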